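import Mathlib.RingTheory.Henselian
import Mathlib.RingTheory.LocalRing.ResidueField.Basic
import Mathlib.FieldTheory.IsAlgClosed.Basic
import Mathlib.Tactic.LinearCombination
import HarnessLib

/-!
# EL♮(3), nose customers: «TWO SMOOTH SHEETS» — the formal splitting `h² + A·q² = (h + c q)(h − c q)`, `c² = −A`,
# at a point where `A` is a unit (Hensel on `T² + A` in a henselian ring with `2` invertible)

res-L1-w45b-nose-w1 g6 (WIDTH seat D-0157 DOOR 1), on res-L1-w45b-lead-1 g19's offer (cell bus 2026-08-29T07:00:34Z (1)): the ring lemma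
behind LEMMA P of the customer certificates `SNU-G7-CERTIFICATE.md` f2094ef1643d0b39 / ADDENDUM A (D9 «ν3-DIRECT», customer `S_ν(G₇) =
V(g₇² + w²B♮₁₄)`) and `SHARP7-CERTIFICATE.md` 70f4d67028538f11 (D11 «Σ5a ci-DIRECT», customer `S♯_ν(G₇) = V(h² + A·q²)`): at a point of the
nose where the coefficient `A` is a UNIT, the surface equation `F = h² + A·q²` splits in the complete (hence henselian) local ring into two
formal sheets `F = (h + c·q)(h − c·q)` with `c` a unit square root of `−A` — Hensel's lemma for `T² + A` (simple root: `2c₀` is a unit since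
`char k ≠ 2` and `A` is a unit), the residue root existing because the residue field is algebraically closed.

* `TwoSheets.exists_sq_add_eq_zero` — `R` henselian along `I`, `2` and `A` units mod `I`, `c₀² + A ∈ I` ⇒ `∃ c, c² + A = 0 ∧ c − c₀ ∈ I`.
* `TwoSheets.exists_isUnit_sq_eq_neg` — `R` local, henselian along `𝔪` (e.g. `𝔪`-adically complete), residue field algebraically closed,
  `2` and `A` units ⇒ `∃ c`, a unit, `c² = −A`.
* ★ `TwoSheets.sq_add_mul_sq_eq_mul` / ★ `TwoSheets.two_sheets` — the splitting `h² + A·q² = (h + c·q)·(h − c·q)` with `c` a unit.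

Pure commutative algebra (Mathlib `HenselianRing`, `IsAlgClosed.exists_pow_nat_eq`); no new fact; DEF-FREE; no `sorry`; standard axioms;
`--supports stmt-ResolutionOfSingularities-20148 --as helper`, counted 0 (customer-certificate support; it proves nothing of EL♮(3)).
Resolution of singularities in positive characteristic is NOT proved anywhere in this tree; nothing of [Hironaka2017] is asserted.
-/

set_option linter.dupNamespace false -- mandated namespace `Summit.<Summit>.<Problem>` of this single-conjunct summit

noncomputable section

open IsLocalRing Polynomial

namespace Summit.ResolutionOfSingularities.ResolutionOfSingularities.Cruxes.EquisingularLiftNat.Sections.TwoSheets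

/-- **Hensel on `T² + A`**: in a ring `R` henselian along `I`, if `2` and `A` are units modulo `I` and `c₀² + A ∈ I`, then `c₀` lifts to an exact
root: `∃ c, c² + A = 0 ∧ c − c₀ ∈ I` (the root `c̄₀` of `T² + Ā` is simple: the derivative `2c̄₀` is a unit because `c̄₀² = −Ā` is).
[folklore; Hensel's lemma, Mathlib `HenselianRing.is_henselian`] -/
theorem exists_sq_add_eq_zero {R : Type*} [CommRing R] (I : Ideal R) [HenselianRing R I]
    (h2 : IsUnit (Ideal.Quotient.mk I 2)) {A c₀ : R} (hA : IsUnit (Ideal.Quotient.mk I A)) (hc₀ : c₀ ^ 2 + A ∈ I) :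
    ∃ c : R, c ^ 2 + A = 0 ∧ c - c₀ ∈ I := by
  have hmonic : (X ^ 2 + C A : R[X]).Monic := monic_X_pow_add_C A two_ne_zero
  have heval : (X ^ 2 + C A : R[X]).eval c₀ ∈ I := by
    simpa only [eval_add, eval_pow, eval_X, eval_C] using hc₀
  -- `c̄₀` is a unit: `c̄₀² = -Ā`
  have hc₀u : IsUnit (Ideal.Quotient.mk I c₀) := by
    have hsq : (Ideal.Quotient.mk I c₀) ^ 2 = -(Ideal.Quotient.mk I A) := by
      have h0 : Ideal.Quotient.mk I (c₀ ^ 2 + A) = 0 := Ideal.Quotient.eq_zero_iff_mem.mpr hc₀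
      rw [map_add, map_pow] at h0
      linear_combination h0
    exact (isUnit_pow_iff two_ne_zero).mp (hsq ▸ hA.neg)
  have hder : IsUnit (Ideal.Quotient.mk I ((X ^ 2 + C A : R[X]).derivative.eval c₀)) := by
    have hd : (X ^ 2 + C A : R[X]).derivative.eval c₀ = 2 * c₀ := by
      simp only [derivative_add, derivative_X_pow, derivative_C, add_zero, eval_mul, eval_C, eval_X,
        Nat.cast_ofNat, Nat.add_one_sub_one, pow_one]
    rw [hd, map_mul]
    exact h2.mul hc₀u
  obtain ⟨c, hroot, hcc₀⟩ := HenselianRing.is_henselian (X ^ 2 + C A) hmonic c₀ heval hder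
  refine ⟨c, ?_, hcc₀⟩
  simpa only [IsRoot.def, eval_add, eval_pow, eval_X, eval_C] using hroot

/-- **A unit has a unit square root of its negative** in a local ring henselian along `𝔪` (e.g. `𝔪`-adically complete — Mathlib instance
`IsAdicComplete.henselianRing`) whose residue field is algebraically closed and in which `2` is a unit: `∃ c`, `IsUnit c`, `c² = −A`.
[folklore; Hensel + algebraically closed residue field] -/
theorem exists_isUnit_sq_eq_neg {R : Type*} [CommRing R] [IsLocalRing R] [HenselianRing R (maximalIdeal R)]
    [IsAlgClosed (ResidueField R)] (h2 : IsUnit (2 : R)) {A : R} (hA : IsUnit A) :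
    ∃ c : R, IsUnit c ∧ c ^ 2 = -A := by
  -- a residue square root of `-Ā`
  obtain ⟨z, hz⟩ := IsAlgClosed.exists_pow_nat_eq (residue R (-A)) two_pos
  obtain ⟨c₀, rfl⟩ := Ideal.Quotient.mk_surjective z
  have hc₀ : c₀ ^ 2 + A ∈ maximalIdeal R := by
    rw [← residue_eq_zero_iff, map_add, map_pow]
    have hz' : residue R c₀ ^ 2 = residue R (-A) := hz
    rw [hz', map_neg, neg_add_cancel]
  have h2' : IsUnit (Ideal.Quotient.mk (maximalIdeal R) 2) := h2.map (Ideal.Quotient.mk (maximalIdeal R))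
  have hA' : IsUnit (Ideal.Quotient.mk (maximalIdeal R) A) := hA.map _
  obtain ⟨c, hc, -⟩ := exists_sq_add_eq_zero (maximalIdeal R) h2' hA' hc₀
  have hc' : c ^ 2 = -A := by linear_combination hc
  refine ⟨c, ?_, hc'⟩
  exact (isUnit_pow_iff two_ne_zero).mp (hc' ▸ hA.neg)

/-- The splitting identity: `c² = −A ⇒ h² + A·q² = (h + c·q)·(h − c·q)`. [folklore] -/
theorem sq_add_mul_sq_eq_mul {R : Type*} [CommRing R] (h q A c : R) (hc : c ^ 2 = -A) :
    h ^ 2 + A * q ^ 2 = (h + c * q) * (h - c * q) := by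
  linear_combination (q ^ 2) * hc

/-- ★ **TWO SMOOTH SHEETS.**  In a local ring henselian along `𝔪` (e.g. the complete local ring of the ambient at a point of the nose) with
algebraically closed residue field and `2` a unit, the equation `F = h² + A·q²` with `A` a UNIT splits as `F = (h + c·q)·(h − c·q)` with `c` a unit,
`c² = −A` — the LEMMA P input of the customer certificates SNU-G7 (D9) / SHARP7 (D11): at the cusps of the nose, where `A ≠ 0`, the surface is
formally the union of two sheets. [OURS · customer-certificate support; counted 0; nothing of EL♮(3) is proved] -/
theorem two_sheets {R : Type*} [CommRing R] [IsLocalRing R] [HenselianRing R (maximalIdeal R)] [IsAlgClosed (ResidueField R)]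
    (h2 : IsUnit (2 : R)) {A : R} (hA : IsUnit A) (h q : R) :
    ∃ c : R, IsUnit c ∧ c ^ 2 = -A ∧ h ^ 2 + A * q ^ 2 = (h + c * q) * (h - c * q) := by
  obtain ⟨c, hcu, hc⟩ := exists_isUnit_sq_eq_neg h2 hA
  exact ⟨c, hcu, hc, sq_add_mul_sq_eq_mul h q A c hc⟩

/-- The same over an `𝔪`-ADICALLY COMPLETE local ring (the case of the certificates: the completed local ring of `ℙ³` at a cusp), through
Mathlib's instance `IsAdicComplete.henselianRing`. [OURS · customer-certificate support; counted 0] -/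
theorem two_sheets_of_isAdicComplete {R : Type*} [CommRing R] [IsLocalRing R] [IsAdicComplete (maximalIdeal R) R]
    [IsAlgClosed (ResidueField R)] (h2 : IsUnit (2 : R)) {A : R} (hA : IsUnit A) (h q : R) :
    ∃ c : R, IsUnit c ∧ c ^ 2 = -A ∧ h ^ 2 + A * q ^ 2 = (h + c * q) * (h - c * q) :=
  two_sheets h2 hA h q

end Summit.ResolutionOfSingularities.ResolutionOfSingularities.Cruxes.EquisingularLiftNat.Sections.TwoSheets

end
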